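import Summits.CriticalPhenomena.PercolationContinuityZ3.Theorems.PercNearOneGluingNoHeavyQuantGateCouplingMixture
import Summits.CriticalPhenomena.PercolationContinuityZ3.Theorems.PercNearOneGluingNoHeavyQuantLightSliceWideHolds
import HarnessLib

/-!
# QUANT lane R8, T-DEC: THE TWO-ROOT GATE-COUPLING IDENTITY — the gate step for a forest of TWO trees is EXACTLY the gate-stable
# DEC of the forest obtained by opening the heavier root ("outer-gate elimination by re-gating", arm-1 g45)

builds on p205010 (kernel theorem, internal audit signed; external expert review pending)

Support file (`--supports stmt-CriticalPhenomena-4575`), QUANT lane seat prim-quant-arm-1 (gen 45, architect); memo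
`run/shared/lean/prim/quant/prim-quant-arm-1-g45/ARCH-LIGHT-G45.md` §4.  Theorems only, standard axioms, no sorries.  Companion of
`…QuantGateCouplingMixture` (the environment/increment mixture); this file treats the two ROOT gates symmetrically.

THE IDENTITY (`twoRoot_gateCoupling`).  Two trees `tᵢ = gate_{qᵢ}(ρᵢ)` (root gates `q₂ ≤ q₁ < 1`... only `a·q₁ ≠ 1`, `q₁ ≠ 0` are
used; `ρᵢ` the OPENED trees, arbitrary laws vanishing above their tops) under a common outer gate `a`:
  `gate_a(t₁ ∗ t₂) = w · (gate_{a q₁} ρ₁ ∗ gate_{a q₂} ρ₂) + (1 − w) · gate_{a q₁}(ρ₁ ∗ gate_{q₂/q₁} ρ₂)`,   `w = (1 − q₁)/(1 − a q₁)`.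
In words: the common gate over two independent roots is the mixture of (P) the two roots scaled INDEPENDENTLY by `a`, and (U) the
heavier root MERGED into the outer gate (outer gate `a q₁`, root 1 opened) with the lighter root re-gated to `q₂/q₁`.  On the root
pattern `(B′B₁, B′B₂)` this is the identity `(1−a)δ₀₀ + a·Bern(q₁)⊗Bern(q₂) = w·Bern(aq₁)⊗Bern(aq₂) + (1−w)·[(1−aq₁)δ₀₀ + aq₁·δ₁⊗Bern(q₂/q₁)]`
(check the three moments `aq₁`, `aq₂`, `aq₁q₂`); the count laws follow because the opened-tree laws `ρᵢ` are untouched.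

WHY IT MATTERS.  Both components have mean EXACTLY `a(q₁R₁ + q₂R₂)` (the target) and floor EXACTLY `min(aq₁y₁, aq₂y₂)` (the true
floor; `yᵢ` the opened floors): (P) is a plain convolution of two gated SDEC laws — DEC at every layer by `ConvClosedT`
(`convClosedT_holds`); (U) is `gate_{aq₁}` of the forest `ρ₁ ⊔ gate_{q₂/q₁}(ρ₂)`, which has ONE FEWER nontrivial gate than `t₁ ⊔ t₂`.
Hence (`sdec_twoRoot_of_opened`): **`t₁ ⊔ t₂` is SDEC at its floor as soon as `ρ₁`, `ρ₂` and the opened forest `ρ₁ ⊔ gate_{q₂/q₁}(ρ₂)`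
are SDEC** — no regime restriction, light or heavy.  In the structural induction on the number of nontrivial gates this settles every
forest whose top layer has exactly two nontrivial trees GIVEN the induction hypothesis for all forests with fewer gates; the step for
`m ≥ 3` top-level trees is the "root-pattern mixture" question RPM_m of the memo (§4–§5; open, exact LP evidence recorded there).

HONEST STATUS.  `SDECConvClosed(TB)`, `TreeBuiltDEC`, `Quant.FarTreeRow` remain OPEN; this is an exact reduction of the two-tree gate step
to a smaller forest, not a proof of the node.  RATE class (log\*) and honest sentence of `run/shared/lean/prim/quant/README.md` unchanged.
[this work]; SDEC: prim-quant-census-2 g53; `ConvClosedT`/`convClosedT_holds`: census-2 g60 (this lane).  Nothing here is a published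
result.  The gluing rows served [cite: KozmaNitzan2024, Conjecture 3 (p. 15)]; product measure [cite: Grimmett1999, §1.3 p. 10].
-/

noncomputable section

namespace Summit.CriticalPhenomena.PercolationContinuityZ3.Theorems

namespace Quant

open Finset

namespace LawDec

/-! ### The identity -/

/-- convolution with a gated law on the LEFT: `gate_q ρ ∗ ν = q·(ρ ∗ ν) + (1−q)·ν` (for `ν` vanishing above its top). [this work] -/
theorem lconv_gate_left (M₁ M₂ : ℕ) (ρ ν : ℕ → ℝ) (q : ℝ) (hνM : ∀ h, M₂ < h → ν h = 0) (h : ℕ) :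
    lconv M₁ M₂ (gate ρ q) ν h = q * lconv M₁ M₂ ρ ν h + (1 - q) * ν h := by
  rw [lconv_comm, lconv_gate_right M₂ M₁ ν ρ q hνM h, lconv_comm]

/-- **THE TWO-ROOT GATE-COUPLING IDENTITY.**  For laws `ρ₁` on `{0..M₁}`, `ρ₂` on `{0..M₂}` (vanishing above their tops), root gates
`q₁ ≠ 0`, `q₂`, and an outer gate `a` with `a·q₁ ≠ 1`:
`gate_a(gate_{q₁}ρ₁ ∗ gate_{q₂}ρ₂) = w·(gate_{aq₁}ρ₁ ∗ gate_{aq₂}ρ₂) + (1−w)·gate_{aq₁}(ρ₁ ∗ gate_{q₂/q₁}ρ₂)`, `w = (1−q₁)/(1−aq₁)`,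
pointwise. [this work] -/
theorem twoRoot_gateCoupling (M₁ M₂ : ℕ) (ρ₁ ρ₂ : ℕ → ℝ) (q₁ q₂ a : ℝ)
    (h₁M : ∀ h, M₁ < h → ρ₁ h = 0) (h₂M : ∀ h, M₂ < h → ρ₂ h = 0) (hq₁ : q₁ ≠ 0) (haq : 1 - a * q₁ ≠ 0) (h : ℕ) :
    gate (lconv M₁ M₂ (gate ρ₁ q₁) (gate ρ₂ q₂)) a h
      = ((1 - q₁) / (1 - a * q₁)) * lconv M₁ M₂ (gate ρ₁ (a * q₁)) (gate ρ₂ (a * q₂)) h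
        + (1 - (1 - q₁) / (1 - a * q₁)) * gate (lconv M₁ M₂ ρ₁ (gate ρ₂ (q₂ / q₁))) (a * q₁) h := by
  have g₂M : ∀ q : ℝ, ∀ k, M₂ < k → gate ρ₂ q k = 0 := by
    intro q k hk; rw [gate_apply, h₂M k hk, if_neg (by omega)]; ring
  rw [gate_apply, gate_apply, lconv_gate_left M₁ M₂ ρ₁ _ q₁ (g₂M q₂) h, lconv_gate_right M₁ M₂ ρ₁ ρ₂ q₂ h₁M h,
    gate_apply, lconv_gate_left M₁ M₂ ρ₁ _ (a * q₁) (g₂M (a * q₂)) h, lconv_gate_right M₁ M₂ ρ₁ ρ₂ (a * q₂) h₁M h,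
    gate_apply, lconv_gate_right M₁ M₂ ρ₁ ρ₂ (q₂ / q₁) h₁M h]
  field_simp
  ring

/-! ### The DEC consequence: the two-tree gate step reduces to the opened forest -/

/-- **THE TWO-TREE GATE STEP FROM THE OPENED FOREST.**  Opened trees `ρ₁` (top-affordable probability law on `{0..M₁}`, `SDEC` at a
floor `0 < y₁ < 1`), `ρ₂` (same at `y₂`), root gates `0 < q₂ ≤ q₁ < 1`, and the forest `ρ₁ ⊔ gate_{q₂/q₁}(ρ₂)` `SDEC` at a floor `w_G`
(`0 ≤ w_G < 1`); an outer gate `0 < a ≤ 1`; a floor `z` with `z ≤ a q₁ y₁`, `z ≤ a q₂ y₂`, `z ≤ a q₁ w_G`, `0 < z`.  Then the doubly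
gated two-tree law `gate_a(gate_{q₁}ρ₁ ∗ gate_{q₂}ρ₂)` is DEC(j) at floor `z` at every layer `j < M₁ + M₂`.  (With `w_G` the true floor
`min(y₁, (q₂/q₁)y₂)` all three bounds read `z ≤ min(aq₁y₁, aq₂y₂)` = the true floor of the gated forest.) [this work] -/
theorem decAt_twoRoot_of_opened (y₁ y₂ wG z q₁ q₂ a : ℝ) (M₁ M₂ : ℕ) (ρ₁ ρ₂ : ℕ → ℝ)
    (hy₁0 : 0 < y₁) (hy₁1 : y₁ < 1) (hy₂0 : 0 < y₂) (hy₂1 : y₂ < 1) (hwG0 : 0 ≤ wG) (hwG1 : wG < 1)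
    (hq₂0 : 0 < q₂) (hq₂₁ : q₂ ≤ q₁) (hq₁1 : q₁ < 1) (ha0 : 0 < a) (ha1 : a ≤ 1) (hz0 : 0 < z)
    (h₁0 : ∀ h, 0 ≤ ρ₁ h) (h₁M : ∀ h, M₁ < h → ρ₁ h = 0) (h₁1 : ∑ h ∈ Finset.range (M₁ + 1), ρ₁ h = 1)
    (hta₁ : y₁ * (M₁ : ℝ) ≤ ∑ h ∈ Finset.range (M₁ + 1), (h : ℝ) * ρ₁ h)
    (h₂0 : ∀ h, 0 ≤ ρ₂ h) (h₂M : ∀ h, M₂ < h → ρ₂ h = 0) (h₂1 : ∑ h ∈ Finset.range (M₂ + 1), ρ₂ h = 1)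
    (hta₂ : y₂ * (M₂ : ℝ) ≤ ∑ h ∈ Finset.range (M₂ + 1), (h : ℝ) * ρ₂ h)
    (hS₁ : SDEC y₁ M₁ ρ₁) (hS₂ : SDEC y₂ M₂ ρ₂)
    (hG : SDEC wG (M₁ + M₂) (lconv M₁ M₂ ρ₁ (gate ρ₂ (q₂ / q₁))))
    (hz₁ : z ≤ a * q₁ * y₁) (hz₂ : z ≤ a * q₂ * y₂) (hzG : z ≤ a * q₁ * wG)
    (j : ℕ) (hj : j < M₁ + M₂) :
    DECAt z j (M₁ + M₂) (gate (lconv M₁ M₂ (gate ρ₁ q₁) (gate ρ₂ q₂)) a) := by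
  have hq₁0 : 0 < q₁ := lt_of_lt_of_le hq₂0 hq₂₁
  have haq₁0 : 0 < a * q₁ := mul_pos ha0 hq₁0
  have haq₁1 : a * q₁ < 1 := by nlinarith
  have haq₂0 : 0 < a * q₂ := mul_pos ha0 hq₂0
  have haq₂1 : a * q₂ ≤ 1 := by nlinarith
  have hr0 : 0 < q₂ / q₁ := div_pos hq₂0 hq₁0
  have hr1 : q₂ / q₁ ≤ 1 := by rw [div_le_one hq₁0]; exact hq₂₁
  have hz1 : z < 1 := by nlinarith
  set S₁ : ℝ := ∑ h ∈ Finset.range (M₁ + 1), (h : ℝ) * ρ₁ h with hS₁def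
  set S₂ : ℝ := ∑ h ∈ Finset.range (M₂ + 1), (h : ℝ) * ρ₂ h with hS₂def
  set w : ℝ := (1 - q₁) / (1 - a * q₁) with hwdef
  have hw0 : 0 ≤ w := div_nonneg (by linarith) (by linarith)
  have hw1 : w ≤ 1 := by rw [hwdef, div_le_one (by linarith)]; nlinarith
  set TE : ℝ := a * (q₁ * S₁ + q₂ * S₂) with hTEdef
  -- laws of the gated opened trees
  obtain ⟨g₁0, g₁M, g₁1⟩ := gate_laws M₁ ρ₁ (a * q₁) haq₁0.le haq₁1.le h₁0 h₁M h₁1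
  obtain ⟨g₂0, g₂M, g₂1⟩ := gate_laws M₂ ρ₂ (a * q₂) haq₂0.le haq₂1 h₂0 h₂M h₂1
  -- component P: plain convolution of the two independently scaled roots — ConvClosedT
  have hP : DECAtT z TE j (M₁ + M₂) (lconv M₁ M₂ (gate ρ₁ (a * q₁)) (gate ρ₂ (a * q₂))) := by
    have d₁ : ∀ j'', DECAtT z (a * q₁ * S₁) j'' M₁ (gate ρ₁ (a * q₁)) := by
      intro j''
      have d : DECAt (a * q₁ * y₁) j'' M₁ (gate ρ₁ (a * q₁)) := by
        by_cases hjM : j'' < M₁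
        · exact hS₁ (a * q₁) haq₁0 haq₁1.le j'' hjM
        · exact decAt_gate_of_top_le M₁ ρ₁ y₁ (a * q₁) hy₁0.le (by nlinarith) haq₁0.le haq₁1.le h₁0 h₁M h₁1 hta₁ j''
            (not_lt.1 hjM)
      have d' := decAt_mono_floor hz₁ (by nlinarith) d
      rwa [decAt_iff_decAtT, sum_mul_gate] at d'
    have d₂ : ∀ j'', DECAtT z (a * q₂ * S₂) j'' M₂ (gate ρ₂ (a * q₂)) := by
      intro j''
      have d : DECAt (a * q₂ * y₂) j'' M₂ (gate ρ₂ (a * q₂)) := by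
        by_cases hjM : j'' < M₂
        · exact hS₂ (a * q₂) haq₂0 haq₂1 j'' hjM
        · exact decAt_gate_of_top_le M₂ ρ₂ y₂ (a * q₂) hy₂0.le (by nlinarith) haq₂0.le haq₂1 h₂0 h₂M h₂1 hta₂ j''
            (not_lt.1 hjM)
      have d' := decAt_mono_floor hz₂ (by nlinarith) d
      rwa [decAt_iff_decAtT, sum_mul_gate] at d'
    have hC := convClosedT_holds z (a * q₁ * S₁) (a * q₂ * S₂) M₁ M₂ j (gate ρ₁ (a * q₁)) (gate ρ₂ (a * q₂)) hz0 hz1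
      g₁0 g₁M g₁1 g₂0 g₂M g₂1 hj (fun j'' _ _ => d₁ j'') (fun j'' _ _ => d₂ j'')
    have e : a * q₁ * S₁ + a * q₂ * S₂ = TE := by rw [hTEdef]; ring
    rwa [e] at hC
  -- component U: the opened forest under the merged gate `a q₁` — induction hypothesis `hG`
  have hU : DECAtT z TE j (M₁ + M₂) (gate (lconv M₁ M₂ ρ₁ (gate ρ₂ (q₂ / q₁))) (a * q₁)) := by
    have d := hG (a * q₁) haq₁0 haq₁1.le j hj
    have d' := decAt_mono_floor hzG (by nlinarith) d
    obtain ⟨r0, rM, r1⟩ := gate_laws M₂ ρ₂ (q₂ / q₁) hr0.le hr1 h₂0 h₂M h₂1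
    rw [decAt_iff_decAtT, sum_mul_gate, sum_mul_lconv M₁ M₂ ρ₁ _ h₁1 r1, sum_mul_gate] at d'
    have e : a * q₁ * (S₁ + q₂ / q₁ * S₂) = TE := by rw [hTEdef]; field_simp
    rwa [e] at d'
  have mix := decAtT_mixture w hw0 hw1 hP hU
  have e : gate (lconv M₁ M₂ (gate ρ₁ q₁) (gate ρ₂ q₂)) a
      = fun h => w * lconv M₁ M₂ (gate ρ₁ (a * q₁)) (gate ρ₂ (a * q₂)) h
          + (1 - w) * gate (lconv M₁ M₂ ρ₁ (gate ρ₂ (q₂ / q₁))) (a * q₁) h := by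
    funext h
    rw [hwdef]
    exact twoRoot_gateCoupling M₁ M₂ ρ₁ ρ₂ q₁ q₂ a h₁M h₂M hq₁0.ne' (by linarith) h
  -- the mean of the doubly gated law
  obtain ⟨t₁0, t₁M, t₁1⟩ := gate_laws M₁ ρ₁ q₁ hq₁0.le hq₁1.le h₁0 h₁M h₁1
  obtain ⟨t₂0, t₂M, t₂1⟩ := gate_laws M₂ ρ₂ q₂ hq₂0.le (hq₂₁.trans hq₁1.le) h₂0 h₂M h₂1
  have hEmean : ∑ h ∈ Finset.range (M₁ + M₂ + 1), (h : ℝ) * gate (lconv M₁ M₂ (gate ρ₁ q₁) (gate ρ₂ q₂)) a h = TE := by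
    rw [sum_mul_gate, sum_mul_lconv M₁ M₂ _ _ t₁1 t₂1, sum_mul_gate, sum_mul_gate, hTEdef]
  rw [decAt_iff_decAtT, hEmean, e]
  exact mix

/-- **COROLLARY (SDEC form, true floors).**  With the opened floors `y₁, y₂` and the opened forest `SDEC` at `min(y₁, (q₂/q₁)·y₂)`... stated
with an explicit floor `wG` and the three inequalities; conclusion: `gate_{q₁}ρ₁ ∗ gate_{q₂}ρ₂` is SDEC at every floor `x` with
`0 < x`, `x ≤ q₁y₁`, `x ≤ q₂y₂`, `x ≤ q₁wG` — i.e. at the forest's true floor when `wG` is the opened forest's true floor. [this work] -/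
theorem sdec_twoRoot_of_opened (y₁ y₂ wG x q₁ q₂ : ℝ) (M₁ M₂ : ℕ) (ρ₁ ρ₂ : ℕ → ℝ)
    (hy₁0 : 0 < y₁) (hy₁1 : y₁ < 1) (hy₂0 : 0 < y₂) (hy₂1 : y₂ < 1) (hwG0 : 0 ≤ wG) (hwG1 : wG < 1)
    (hq₂0 : 0 < q₂) (hq₂₁ : q₂ ≤ q₁) (hq₁1 : q₁ < 1) (hx0 : 0 < x)
    (h₁0 : ∀ h, 0 ≤ ρ₁ h) (h₁M : ∀ h, M₁ < h → ρ₁ h = 0) (h₁1 : ∑ h ∈ Finset.range (M₁ + 1), ρ₁ h = 1)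
    (hta₁ : y₁ * (M₁ : ℝ) ≤ ∑ h ∈ Finset.range (M₁ + 1), (h : ℝ) * ρ₁ h)
    (h₂0 : ∀ h, 0 ≤ ρ₂ h) (h₂M : ∀ h, M₂ < h → ρ₂ h = 0) (h₂1 : ∑ h ∈ Finset.range (M₂ + 1), ρ₂ h = 1)
    (hta₂ : y₂ * (M₂ : ℝ) ≤ ∑ h ∈ Finset.range (M₂ + 1), (h : ℝ) * ρ₂ h)
    (hS₁ : SDEC y₁ M₁ ρ₁) (hS₂ : SDEC y₂ M₂ ρ₂)
    (hG : SDEC wG (M₁ + M₂) (lconv M₁ M₂ ρ₁ (gate ρ₂ (q₂ / q₁))))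
    (hx₁ : x ≤ q₁ * y₁) (hx₂ : x ≤ q₂ * y₂) (hxG : x ≤ q₁ * wG) :
    SDEC x (M₁ + M₂) (lconv M₁ M₂ (gate ρ₁ q₁) (gate ρ₂ q₂)) := by
  intro a ha0 ha1 j hj
  exact decAt_twoRoot_of_opened y₁ y₂ wG (a * x) q₁ q₂ a M₁ M₂ ρ₁ ρ₂ hy₁0 hy₁1 hy₂0 hy₂1 hwG0 hwG1 hq₂0 hq₂₁ hq₁1 ha0 ha1
    (mul_pos ha0 hx0) h₁0 h₁M h₁1 hta₁ h₂0 h₂M h₂1 hta₂ hS₁ hS₂ hG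
    (by nlinarith [mul_le_mul_of_nonneg_left hx₁ ha0.le])
    (by nlinarith [mul_le_mul_of_nonneg_left hx₂ ha0.le])
    (by nlinarith [mul_le_mul_of_nonneg_left hxG ha0.le]) j hj

end LawDec

end Quant

end Summit.CriticalPhenomena.PercolationContinuityZ3.Theorems
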